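import Summits.HodgeConjecture.HodgeConjecture.Theorems.SignSymmetricPowersOrbitDataMono
import Literature.AlgebraicGeometry.HodgeTheory.SignSymmetricOneSeedHodgeGroup
import HarnessLib

/-!
(hN KEYED to the consumed instance (odd `n`, `g₀` a monomial `c·xᵢ^d`: the two extra antecedents `Odd n →` and `(∃ i c, g₀ = c • X i ^ d) →` are in scope at the single consumption site) — registry v25k of seat 19716-p2 g10; otherwise VERBATIM the `…Solo` file.)

# Crux K1-B `VeryGeneralSignCommutatorsInHg` and the rung leaf modulo {hpg3∕PG, hCDK, hN} — BOTH Picard–Lefschetz binders DISCHARGED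
# (prover-Bx p680592 one node; seat 20241-p1 p684662 exchanged pair; route `SignSymmetricPowers`, item stmt-HodgeConjecture-19716; registry v25)

Prover seat `hodge-nonav-19716-p2` (g10), cell `hodge-nonav`; helper `--supports stmt-HodgeConjecture-19716`; sorry-free, no definition, no
new named fact.  prover-Bx's ODP-ISOTOPY port is COMPLETE: `NodalPencil.picardLefschetz_oneNode_monomial` (p680592) proves the body of the
one-node Picard–Lefschetz binder `picardLefschetz_oneNode` for every monomial co-pencil direction `g = a·xᵢ^d`, and every one-node instance the
K1-B telescope consumes is such (`x₄^d`, `x₀^d` at the Π∕L sites, `(ψ/2)·x_j^d` at the `A₃` site).  This file is the VERBATIM port of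
`SignSymmetricPowersFourFactsKeyed` over the chain in which BOTH Picard–Lefschetz binders are replaced by theorems (`_solo` port of the `_pair` chain): `PicardLefschetzOneNodeMonomialShapes`,
`PicardLefschetzSymmetricA3OfExchangedPair`, `SignSymmetricPowersMeridianGenerationMonomial` (GEN with its directions exposed),
`SignSymmetricPowersPencilTransvectionsPair`, `SignSymmetricPowersLinkConfluenceNPair`, `SignSymmetricPowersConfluenceLinkGNPair`,
`SignSymmetricPowersOrbitDataPair`.  All theorem names carry the suffix `_pair` («only the pair binder remains»).

* `veryGeneralSignCommutatorsInHg_of_genusBound_three_facts_mono (hpg3) (hCDK) (hNC)` —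
  **K1-B ⟸ {hpg3 (landed), hCDK, hN}**; PG variants; rung-leaf variants (suffix `_mono`; the `_pair` chain is the parent).

Registry consequence (P3's call; this seat registers): 19716 v25 = {stub_cdkCover, stub_a3NonComm} — v24's `stub_picardLefschetzExchangedPair` is
DISCHARGED in the consumed (monomial) instances by `picardLefschetz_exchangedPair_monomial` (p684662).  CONDITIONAL; nothing here says HC ∕ HC_AV is proved; rung F-H1
not moved.
-/

noncomputable section

set_option linter.dupNamespace false
set_option linter.unusedVariables false
set_option maxHeartbeats 800000

namespace Summit.HodgeConjecture.HodgeConjecture.Theorems.SignSymmetricPowersFourFactsMono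

open Literature.AlgebraicGeometry.Motives Literature.AlgebraicGeometry.HodgeTheory
open Literature.AlgebraicGeometry.HodgeTheory.BettiUniverse
open Literature.AlgebraicTopology.SingularHomology
open CategoryTheory
open Summit.HodgeConjecture.HodgeConjecture.Theorems.SignSymmetricPowersConfluenceLinkG (isSupportedOn_of_coeff_odd_eq_zero)
open Summit.HodgeConjecture.HodgeConjecture.Theorems.SignSymmetricPowersPencilOrbitData
open Summit.HodgeConjecture.HodgeConjecture.Theorems.SignSymmetricPowersSevenFacts
open Literature.AlgebraicGeometry.FundamentalGroup (affineHypersurfaceComplement_meridians_normalClosure_eq_top_holds)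
open Summit.HodgeConjecture.HodgeConjecture.Theorems.SignSymmetricPowersFourFactsGeometricGenus

/-- **K1-B `VeryGeneralSignCommutatorsInHg` from the deck Hodge numbers and the named facts {ZvK, D1, hCDK, hN}** (verbatim
`SignSymmetricPowersFourFactsPair.veryGeneralSignCommutatorsInHg_of_signDeckHodge_pair` with the exchanged-pair binder deleted — 20241-p1's theorem
serves it): the envelope is `signPencilEnvelope_mono` (fixed centres of unknown sign) and Theorem A's
algebra is the W-ELIM kernel `commutator_mem_hodgeGroup_of_signSymmetric_of_eigenCentres` (`SignSymmetricOneSeedHodgeGroup`: one seed side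
suffices, `U_{δ−σδ}(s) = U_{δ+σδ}(−s)·U_δ(2s)U_{σδ}(2s)`) instead of `commutator_mem_hodgeGroup_of_signSymmetric`.  CONDITIONAL result.
[cite: VoisinHodgeII2003, §6.1.3 Thm. 6.10 and Cor. 6.12] [cite: Deligne1980, §4.4 (4.4.1)–(4.4.4^α)] -/
theorem veryGeneralSignCommutatorsInHg_of_signDeckHodge_mono
    (hSDH : open Literature.AlgebraicGeometry.Motives Literature.AlgebraicGeometry.HodgeTheory Literature.AlgebraicGeometry.HodgeTheory.BettiUniverse CategoryTheory.Limits in let pmul2 : List (ℕ × ℕ) → List (ℕ × ℕ) → List (ℕ × ℕ) := fun a b => (List.range (a.length + b.length - 1)).map fun k => (((List.range (k + 1)).map fun i => (a.getD i (0, 0)).1 * (b.getD (k - i) (0, 0)).1 + (a.getD i (0, 0)).2 * (b.getD (k - i) (0, 0)).2).sum, ((List.range (k + 1)).map fun i => (a.getD i (0, 0)).1 * (b.getD (k - i) (0, 0)).2 + (a.getD i (0, 0)).2 * (b.getD (k - i) (0, 0)).1).sum); let fac : ℕ → Bool → List (ℕ × ℕ) := fun d odd => (List.range (d - 1)).map fun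 k => if odd ∧ ¬ Even k then (0, 1) else (1, 0); let shn : ℕ → ℕ → ℕ → ℕ := fun d j q => if (q + 1) * d < 5 then 0 else if j = 0 then (([fac d true, fac d false, fac d false, fac d false].foldl pmul2 (fac d true)).getD ((q + 1) * d - 5) (0, 0)).1 else (([fac d true, fac d false, fac d false, fac d false].foldl pmul2 (fac d true)).getD ((q + 1) * d - 5) (0, 0)).2; ∀ ⦃d : ℕ⦄, Even d → 4 ≤ d → ∀ f : MvPolynomial (Fin 5) ℂ, f.IsHomogeneous d → (∀ e : Fin 5 →₀ ℕ, ¬ Even (e 0 + e 1) → f.coeff e = 0) → SmoothHypersurface.IsNonsingularForm ℂ f → ∀ (hXF : IsSmoothProjective 3 (SmoothHypersurface.hypersurface f)) (ha : (fun i : Fin 5 => if (i : ℕ) < 2 then (-1 : ℂˣ) else 1) ∈ diagonalStabilizer f), ∀ j q : ℕ, j < 2 → q ≤ 3 → Module.finrank ℂ ↥(Module.End.eigenspace ((pull (diagonalAut f ha) 3).baseChange ℂ) ((-1 : ℂ) ^ j) ⊓ (hodge exists_isReal_hodgeModel_holds hXF 3).piece ((3 : ℤ) - q) q) = shn d j 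q)
    (hZvK : Literature.AlgebraicGeometry.FundamentalGroup.affineHypersurfaceComplement_meridians_normalClosure_eq_top)
    (hD1 : Literature.AlgebraicGeometry.HodgeTheory.discriminant_localBranches_nodal)
    (hCDK : Literature.AlgebraicGeometry.HodgeTheory.cmsp_nonHodgeGenericPoints_countable_algebraic_cover)
    (hNC : ∀ (n d : ℕ) (f₁ g₀ g₂ : MvPolynomial (Fin (n + 2)) ℂ) (j k : Fin (n + 2)) (a : Fin (n + 2) → ℂˣ),
      1 ≤ n → 1 ≤ d → Odd n → (∃ (i : Fin (n + 2)) (c : ℂ), g₀ = c • MvPolynomial.X i ^ d) →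
      f₁.IsHomogeneous d → g₀.IsHomogeneous d → g₂.IsHomogeneous d → Literature.AlgebraicGeometry.HodgeTheory.IsSymmetricA3Datum f₁ g₀ g₂ j k a →
      ∀ (εa εb : ℝ) (ψ : ℂ → ℂ), Literature.AlgebraicGeometry.HodgeTheory.IsSymmetricA3Bifurcation f₁ g₀ g₂ j a εa εb ψ →
        ∃ εa' : ℝ, 0 < εa' ∧ εa' ≤ εa ∧ Literature.AlgebraicGeometry.HodgeTheory.SymmetricA3NonCommutation n d f₁ g₀ g₂ ψ εa') :
    Summit.HodgeConjecture.HodgeConjecture.Theses.SignSymmetricPowers.VeryGeneralSignCommutatorsInHg := by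
  have hMC : Literature.AlgebraicGeometry.FundamentalGroup.affineHypersurfaceComplement_meridian_isConj :=
    Literature.AlgebraicGeometry.FundamentalGroup.affineHypersurfaceComplement_meridian_isConj_holds
  refine Summit.HodgeConjecture.HodgeConjecture.Theorems.SignSymmetricPowersModelTransfer.stub_modelTransfer ?_
  intro d hd h4d
  obtain ⟨𝒳, S, u, hu, h𝒳, hqp, hsm, hirr, hU, A, hA, hfin, pt, hALG, hMEM⟩ :=
    SignSymmetricPowersOrbitDataMono.signPencilEnvelope_mono hZvK hD1 hNC hMC hd h4d
  haveI hHTF : HodgeTensorFacts.{0, 0} := hodgeTensorFacts_holds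
  haveI : ∀ t : ComplexPoints S, Module.Finite ℚ (bettiCohomology (fiberOver u t) 3) := hfin
  -- the Cattani–Deligne–Kaplan cover of the non-Hodge-generic points of the base
  obtain ⟨W, hW, hcov⟩ := hCDK u 3 3 hu hqp hsm hirr hU A hA
  -- each member of the cover is avoided off one nonzero polynomial condition on the ι-even coefficients
  choose G hG₀ hG using fun j => hALG (W j) (hW j).1 (hW j).2
  -- v5: prepend the nonsingular-avoidance polynomial `g₀`, so that very general members are NONSINGULAR FORMS (this
  -- excludes the degenerate corners `f = c·G^k`, `k ≥ 2`, where `V₊(f)_red` is a smooth threefold of lower degree)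
  obtain ⟨g₀, hg₀, hNSg⟩ := Summit.HodgeConjecture.HodgeConjecture.Theorems.SignSymmetricPowersNonsingularAvoidance.stub_signNonsingularAvoidance hd h4d
  refine ⟨fun i => if i = 0 then g₀ else G (i - 1), ?_, ?_⟩
  · intro i
    by_cases hi : i = 0
    · simpa only [hi, if_true] using hg₀
    · simpa only [hi, if_false] using hG₀ (i - 1)
  intro f hf hev hgen' hXF ha
  have hJ : SmoothHypersurface.IsNonsingularForm ℂ f := hNSg f hf (by simpa only [if_true] using hgen' 0)
  have hgen : ∀ j, MvPolynomial.eval (fun e : {e : Fin 5 →₀ ℕ // e.degree = d} => f.coeff e.1) (G j) ≠ 0 := fun j => by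
    simpa only [Nat.succ_ne_zero, if_false, Nat.add_sub_cancel] using hgen' (j + 1)
  -- Deck clauses: `σ_f^{*2} = 1` and `σ_f^*` a `tr ∘ cup` isometry (tree), and the deck Hodge numbers from `hSDH`
  obtain ⟨ha', h1, h2⟩ := exists_signDeckModel_clauses_one_two f hev hXF
  refine ⟨⟨h1, h2, hSDH hd h4d f hf hev hJ hXF ha'⟩, ?_⟩
  intro g h hg hh
  obtain ⟨φ, B, hB, hBn, τ, hτ, T, D, hNon, hτB, hφτ, hφB, hHG, hT, hD, hTsign, hseed, hspanPos, hconnPos,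
    hspanNeg, hconnNeg⟩ := hMEM f hf hev hJ hXF ha
  haveI := finite hXF 3
  haveI : Nontrivial (bettiCohomology (fiberOver u (pt f)) 3) := hNon
  -- the classifying point of a very general member is Hodge generic
  have hsgen : IsHodgeGenericPoint u 3 hU hu A hA ⟨pt f, Set.mem_univ _⟩ := by
    by_contra hns
    obtain ⟨j, hj⟩ := hcov ⟨pt f, Set.mem_univ _⟩ hns
    exact hG j f hf hev hXF (hgen j) hj
  -- CMSP 15.3.7 (ii), now a THEOREM (quasi-projective total space, irreducible base): the algebraic monodromy group
  -- `Mon⁰ = (Γ^Zar)⁰` lies in the Mumford–Tate group of the fibre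
  have hΓ : glIdentityComponent (ratMonodromyGroup u 3 hU ⟨pt f, Set.mem_univ _⟩) ⊆
      (((A (pt f)).hodgeStructure (hu.isSmoothProjective (pt f)) (hA (pt f)) 3).mumfordTateGroup : Set (bettiCohomology (fiberOver u (pt f)) 3 ≃ₗ[ℚ] bettiCohomology (fiberOver u (pt f)) 3)) :=
    (deligne_finiteIndex_monodromy_le_mumfordTateGroup_of_isQuasiProjectiveOver u 3 3 hu h𝒳 hqp hsm hirr hU A hA
      ⟨pt f, Set.mem_univ _⟩ hsgen).2
  -- transport the two σ-centraliser isometries to the fibre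
  have hστ : ∀ y, τ (φ.symm y) = φ.symm (pull (diagonalAut f ha) 3 y) := fun y => by
    apply φ.injective
    rw [hφτ, LinearEquiv.apply_symm_apply, LinearEquiv.apply_symm_apply]
  have cenτ : ∀ k : bettiCohomology (SmoothHypersurface.hypersurface f) 3 ≃ₗ[ℚ] bettiCohomology (SmoothHypersurface.hypersurface f) 3,
      (∀ x, k (pull (diagonalAut f ha) 3 x) = pull (diagonalAut f ha) 3 (k x)) →
      ∀ x, ((φ.trans k).trans φ.symm) (τ x) = τ (((φ.trans k).trans φ.symm) x) := by
    intro k hk x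
    simp only [LinearEquiv.trans_apply]
    rw [hφτ, hk, hστ]
  have cenB : ∀ k : bettiCohomology (SmoothHypersurface.hypersurface f) 3 ≃ₗ[ℚ] bettiCohomology (SmoothHypersurface.hypersurface f) 3,
      (∀ x y, tr hXF (3 + 3) (cup (SmoothHypersurface.hypersurface f) 3 3 (k x) (k y)) = tr hXF (3 + 3) (cup (SmoothHypersurface.hypersurface f) 3 3 x y)) →
      ∀ x y, B (((φ.trans k).trans φ.symm) x) (((φ.trans k).trans φ.symm) y) = B x y := by
    intro k hk x y
    simp only [LinearEquiv.trans_apply]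
    rw [hφB, LinearEquiv.apply_symm_apply, LinearEquiv.apply_symm_apply, hk, ← hφB]
  -- Theorem A's algebra with fixed centres of UNKNOWN sign (W-ELIM kernel, landed): commutators of the sign-symmetric
  -- centraliser of the fibre lie in its Hodge group
  have hcomm := commutator_mem_hodgeGroup_of_signSymmetric_of_eigenCentres
    ((A (pt f)).hodgeStructure (hu.isSmoothProjective (pt f)) (hA (pt f)) 3)
    (smoothProjective_hodgeStructure_isPolarizable_holds (hu.isSmoothProjective (pt f)) (A (pt f))
      (hA (pt f)) 3) ⟨1, by norm_num⟩ hB hBn hτ hτB hΓ hT hD hTsign hseed hspanPos hconnPos hspanNeg hconnNeg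
    (cenτ g hg.1) (cenB g hg.2) (cenτ h hh.1) (cenB h hh.2)
  -- transport back to `H³(X_f;ℚ)` along `φ` (Hodge groups correspond)
  have hback := hHG _ hcomm
  have hid : (φ.symm.trans (((φ.trans g).trans φ.symm) * ((φ.trans h).trans φ.symm) *
      ((φ.trans g).trans φ.symm)⁻¹ * ((φ.trans h).trans φ.symm)⁻¹)).trans φ = g * h * g⁻¹ * h⁻¹ := by
    have hinv : ∀ k : bettiCohomology (SmoothHypersurface.hypersurface f) 3 ≃ₗ[ℚ] bettiCohomology (SmoothHypersurface.hypersurface f) 3,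
        ((φ.trans k).trans φ.symm)⁻¹ = (φ.trans k⁻¹).trans φ.symm := by
      intro k
      rw [inv_eq_iff_mul_eq_one]
      ext x
      simp
    rw [hinv, hinv]
    ext x
    simp
  rw [hid] at hback
  exact hback

/-- **Crux K1-B `VeryGeneralSignCommutatorsInHg` modulo {`h^{3,0} ≤ C(d−1,4)` (inlined), hCDK, hNC}** (both PL inputs are theorems:
p680592, p684662): the kernel `veryGeneralSignCommutatorsInHg_of_signDeckHodge_mono` fed `signDeckHodge_of_genusBound hpg3`, with ZvK
and the nodal local branches of the discriminant supplied by their tree theorems. CONDITIONAL; nothing here says HC ∕ HC_AV is proved. [cite: Arapura2012, §17.3 (17.3.1)]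
[cite: VoisinHodgeII2003, §6.1.3 Cor. 6.12] [cite: CattaniDeligneKaplan1995, Thm. 1.1 and Cor. 1.2] -/
theorem veryGeneralSignCommutatorsInHg_of_genusBound_three_facts_mono
    (hpg3 : ∀ ⦃d : ℕ⦄ (f : MvPolynomial (Fin 5) ℂ), f.IsHomogeneous d → SmoothHypersurface.IsNonsingularForm ℂ f →
      ∀ (hXF : IsSmoothProjective 3 (SmoothHypersurface.hypersurface f)),
        Module.finrank ℂ ↥((BettiUniverse.hodge exists_isReal_hodgeModel_holds hXF 3).piece 3 0) ≤ (d - 1).choose 4)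
    (hCDK : Literature.AlgebraicGeometry.HodgeTheory.cmsp_nonHodgeGenericPoints_countable_algebraic_cover)
    (hNC : ∀ (n d : ℕ) (f₁ g₀ g₂ : MvPolynomial (Fin (n + 2)) ℂ) (j k : Fin (n + 2)) (a : Fin (n + 2) → ℂˣ),
      1 ≤ n → 1 ≤ d → Odd n → (∃ (i : Fin (n + 2)) (c : ℂ), g₀ = c • MvPolynomial.X i ^ d) →
      f₁.IsHomogeneous d → g₀.IsHomogeneous d → g₂.IsHomogeneous d → Literature.AlgebraicGeometry.HodgeTheory.IsSymmetricA3Datum f₁ g₀ g₂ j k a →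
      ∀ (εa εb : ℝ) (ψ : ℂ → ℂ), Literature.AlgebraicGeometry.HodgeTheory.IsSymmetricA3Bifurcation f₁ g₀ g₂ j a εa εb ψ →
        ∃ εa' : ℝ, 0 < εa' ∧ εa' ≤ εa ∧ Literature.AlgebraicGeometry.HodgeTheory.SymmetricA3NonCommutation n d f₁ g₀ g₂ ψ εa') :
    Summit.HodgeConjecture.HodgeConjecture.Theses.SignSymmetricPowers.VeryGeneralSignCommutatorsInHg :=
  veryGeneralSignCommutatorsInHg_of_signDeckHodge_mono
    (signDeckHodge_of_genusBound hpg3) affineHypersurfaceComplement_meridians_normalClosure_eq_top_holds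
    discriminant_localBranches_nodal_holds @hCDK @hNC

/-- **Crux K1-B `VeryGeneralSignCommutatorsInHg` modulo {PG, hCDK, hNC}** (PG = `Arapura2012_hypersurface_geometricGenus`, shared
with K1-A). CONDITIONAL; nothing here says HC ∕ HC_AV is proved. [cite: Arapura2012, §17.3 (17.3.1)]
[cite: VoisinHodgeII2003, §6.1.3 Cor. 6.12] [cite: CattaniDeligneKaplan1995, Thm. 1.1 and Cor. 1.2] -/
theorem veryGeneralSignCommutatorsInHg_of_geometricGenus_three_facts_mono
    (hPG : Literature.AlgebraicGeometry.HodgeTheory.Arapura2012_hypersurface_geometricGenus)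
    (hCDK : Literature.AlgebraicGeometry.HodgeTheory.cmsp_nonHodgeGenericPoints_countable_algebraic_cover)
    (hNC : ∀ (n d : ℕ) (f₁ g₀ g₂ : MvPolynomial (Fin (n + 2)) ℂ) (j k : Fin (n + 2)) (a : Fin (n + 2) → ℂˣ),
      1 ≤ n → 1 ≤ d → Odd n → (∃ (i : Fin (n + 2)) (c : ℂ), g₀ = c • MvPolynomial.X i ^ d) →
      f₁.IsHomogeneous d → g₀.IsHomogeneous d → g₂.IsHomogeneous d → Literature.AlgebraicGeometry.HodgeTheory.IsSymmetricA3Datum f₁ g₀ g₂ j k a →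
      ∀ (εa εb : ℝ) (ψ : ℂ → ℂ), Literature.AlgebraicGeometry.HodgeTheory.IsSymmetricA3Bifurcation f₁ g₀ g₂ j a εa εb ψ →
        ∃ εa' : ℝ, 0 < εa' ∧ εa' ≤ εa ∧ Literature.AlgebraicGeometry.HodgeTheory.SymmetricA3NonCommutation n d f₁ g₀ g₂ ψ εa') :
    Summit.HodgeConjecture.HodgeConjecture.Theses.SignSymmetricPowers.VeryGeneralSignCommutatorsInHg :=
  veryGeneralSignCommutatorsInHg_of_genusBound_three_facts_mono (genusBound_of_geometricGenus hPG) @hCDK @hNC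

/-- **The rung leaf `SignThreefoldPowersHodge` modulo {PG, hCDK, hNC}** (composition with the landed
`signThreefoldPowersHodge_of_veryGeneralSignCommutatorsInHg`). CONDITIONAL; rung F-H1 not moved. [cite: Arapura2012, §17.3 (17.3.1)]
[cite: CattaniDeligneKaplan1995, Thm. 1.1 and Cor. 1.2] -/
theorem signThreefoldPowersHodge_of_geometricGenus_three_facts_mono
    (hPG : Literature.AlgebraicGeometry.HodgeTheory.Arapura2012_hypersurface_geometricGenus)
    (hCDK : Literature.AlgebraicGeometry.HodgeTheory.cmsp_nonHodgeGenericPoints_countable_algebraic_cover)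
    (hNC : ∀ (n d : ℕ) (f₁ g₀ g₂ : MvPolynomial (Fin (n + 2)) ℂ) (j k : Fin (n + 2)) (a : Fin (n + 2) → ℂˣ),
      1 ≤ n → 1 ≤ d → Odd n → (∃ (i : Fin (n + 2)) (c : ℂ), g₀ = c • MvPolynomial.X i ^ d) →
      f₁.IsHomogeneous d → g₀.IsHomogeneous d → g₂.IsHomogeneous d → Literature.AlgebraicGeometry.HodgeTheory.IsSymmetricA3Datum f₁ g₀ g₂ j k a →
      ∀ (εa εb : ℝ) (ψ : ℂ → ℂ), Literature.AlgebraicGeometry.HodgeTheory.IsSymmetricA3Bifurcation f₁ g₀ g₂ j a εa εb ψ →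
        ∃ εa' : ℝ, 0 < εa' ∧ εa' ≤ εa ∧ Literature.AlgebraicGeometry.HodgeTheory.SymmetricA3NonCommutation n d f₁ g₀ g₂ ψ εa') :
    Summit.HodgeConjecture.HodgeConjecture.Theses.SignSymmetricPowers.SignThreefoldPowersHodge :=
  SignSymmetricPowersSignThreefoldPowersHodge.signThreefoldPowersHodge_of_veryGeneralSignCommutatorsInHg
    (veryGeneralSignCommutatorsInHg_of_geometricGenus_three_facts_mono @hPG @hCDK @hNC)

/-- The same rung leaf modulo {`h^{3,0} ≤ C(d−1,4)` (inlined), hCDK, hNC}. CONDITIONAL; rung F-H1 not moved.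
[cite: Arapura2012, §17.3 (17.3.1)] [cite: CattaniDeligneKaplan1995, Thm. 1.1 and Cor. 1.2] -/
theorem signThreefoldPowersHodge_of_genusBound_three_facts_mono
    (hpg3 : ∀ ⦃d : ℕ⦄ (f : MvPolynomial (Fin 5) ℂ), f.IsHomogeneous d → SmoothHypersurface.IsNonsingularForm ℂ f →
      ∀ (hXF : IsSmoothProjective 3 (SmoothHypersurface.hypersurface f)),
        Module.finrank ℂ ↥((BettiUniverse.hodge exists_isReal_hodgeModel_holds hXF 3).piece 3 0) ≤ (d - 1).choose 4)
    (hCDK : Literature.AlgebraicGeometry.HodgeTheory.cmsp_nonHodgeGenericPoints_countable_algebraic_cover)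
    (hNC : ∀ (n d : ℕ) (f₁ g₀ g₂ : MvPolynomial (Fin (n + 2)) ℂ) (j k : Fin (n + 2)) (a : Fin (n + 2) → ℂˣ),
      1 ≤ n → 1 ≤ d → Odd n → (∃ (i : Fin (n + 2)) (c : ℂ), g₀ = c • MvPolynomial.X i ^ d) →
      f₁.IsHomogeneous d → g₀.IsHomogeneous d → g₂.IsHomogeneous d → Literature.AlgebraicGeometry.HodgeTheory.IsSymmetricA3Datum f₁ g₀ g₂ j k a →
      ∀ (εa εb : ℝ) (ψ : ℂ → ℂ), Literature.AlgebraicGeometry.HodgeTheory.IsSymmetricA3Bifurcation f₁ g₀ g₂ j a εa εb ψ →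
        ∃ εa' : ℝ, 0 < εa' ∧ εa' ≤ εa ∧ Literature.AlgebraicGeometry.HodgeTheory.SymmetricA3NonCommutation n d f₁ g₀ g₂ ψ εa') :
    Summit.HodgeConjecture.HodgeConjecture.Theses.SignSymmetricPowers.SignThreefoldPowersHodge :=
  SignSymmetricPowersSignThreefoldPowersHodge.signThreefoldPowersHodge_of_veryGeneralSignCommutatorsInHg
    (veryGeneralSignCommutatorsInHg_of_genusBound_three_facts_mono hpg3 @hCDK @hNC)

end Summit.HodgeConjecture.HodgeConjecture.Theorems.SignSymmetricPowersFourFactsMono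

end
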